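import Literature.AlgebraicGeometry.Resolution.SmoothEquivalenceNormalization
import Literature.AlgebraicGeometry.Resolution.InseparableLocalUniformizationAlgebra
import Mathlib.RingTheory.Smooth.IntegralClosure
import Mathlib.RingTheory.Etale.Field
import Mathlib.RingTheory.Polynomial.UniqueFactorization
import Mathlib.RingTheory.Artinian.Module
import Mathlib.RingTheory.Ideal.Colon
import Mathlib.RingTheory.Flat.TorsionFree
import Mathlib.FieldTheory.PurelyInseparable.Exponent
import Mathlib.Algebra.CharP.Reduced
import HarnessLib

/-!
# Inseparable local uniformization: Lemma 2.8.5 (Temkin 2013) for normal schemes, proved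

Topic: `Literature/AlgebraicGeometry/Resolution`. M. Temkin, *Inseparable local uniformization*,
J. Algebra 373 (2013) 65–119 = arXiv:0804.1554v3, Lemma 2.8.5 (p. 31; in the earlier arXiv
version held in the literature store, `paper:arxiv-0804.1554`, 41 pp., it is Lemma 2.7.5 on
p. 19, with the same wording, and Lemma 2.3.9 is Lemma 2.2.9, pp. 9–10):

> "Let `X → S` and `Y → S` be dominant morphisms between integral schemes and let `x ∈ X`,
> `y ∈ Y` be points which are smooth-equivalent over `S`. Assume that `k′/k(S)` is a finite
> purely inseparable extension and set `X′ = Nr_{k′k(X)}(X)` and `Y′ = Nr_{k′k(Y)}(Y)`. Then the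
> preimages `x′ ∈ X′` and `y′ ∈ Y′` of `x` and `y` are smooth-equivalent over `S`."
> Proof (printed): "Choose smooth `S`-morphisms `f : Z → X` and `Z → Y` such that `x` and `y`
> are the images of a point `z`, and set `Z′ = Nr_{k′k(Z)}(Z)`. The morphisms `X′ → X`, `Y′ → Y`
> and `Z′ → Z` are bijective, hence we should only check that the induced morphisms
> `f′ : Z′ → X′` and `Z′ → Y′` are smooth. But the latter was proved in Lemma 2.3.9 (ii)."

## What is proved

The tree's first rendering `Temkin2013_Lemma285` (`InseparableLocalUniformizationLemmas.lean`:
`X = Spec A`, `Y = Spec B` merely integral, conclusion for ALL primes `x′`, `y′` over `x`, `y`) is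
false and is REFUTED in `SmoothEquivalenceNormalization.lean` (`not_temkin2013_Lemma285`, the
affine line with two points glued); that file vendors the corrected rendering
`Temkin2013_Lemma285_normal` — the same statement with `IsIntegrallyClosed A`,
`IsIntegrallyClosed B` (`X`, `Y` NORMAL, as they are wherever the lemma is applied: proof of
Thm. 4.1.1, Step 4, p. 49, `Xᵢ = Nr_{Kᵢ}(X)`, `Yᵢ = Nr_{mᵢ}(Y)`; for normal `X` the map `X′ → X`
is bijective, `prime_eq_of_comap_eq` below, so `x′` is "the preimage") — as a named fact "not
reproduced". This file PROVES it:

* `Temkin2013_Lemma285_normal_holds : Temkin2013_Lemma285_normal`.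

(A second counterexample to the non-normal rendering, for the record: over `S = Spec k`,
`k′ = k`, let `X = Y = Spec A` with `A ⊂ A′ = k[x,y,z]/(xy - z²)` the functions taking the same
value at the vertex `P` and at the smooth point `Q = (1,1,1)` of the cone; `A′ = A + A·x` is the
normalization of `A`, the glued point is smooth-equivalent to itself, `P` and `Q` both lie over
it, but `(X′, P)` and `(X′, Q)` are not smooth-equivalent over `k`, since a common smooth cover
would make the vertex regular by flat descent.)

## The proof (affine, following the printed architecture)

Let `Z = Spec D` be the common smooth cover (`D` smooth over `A` and over `B`, compatibly over
`R₀`, with a prime `z = r` over `x` and `y`), `q = p^e` the exponent of `k′/κ` (`insepExp`;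
`q = 1` in characteristic `0`), `A′ = Nr_{K′}(A) = integralClosure A K'`, `B′ = Nr_{M′}(B)`.

* `Z′`: the ring `A′ ⊗_A D`, smooth over `A′` by base change (this is `Nr_{k′k(Z)}(Z)`: by
  Mathlib's theorem that smooth base change commutes with integral closure,
  `TensorProduct.toIntegralClosure_bijective_of_smooth`, `A′ ⊗_A D` is the integral closure of
  `D` in the generic fibre `K′ ⊗_A D`; `exists_toGen_eq_of_pow_eq`).
* `Z′ → Y′`: the ring map `crossHom : B′ → A′ ⊗_A D`, `b ↦` the unique `q`-th root of `1 ⊗ b^q`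
  (`b^q ∈ B` as `B` is normal, `powHom`). Existence of the root (`exists_root`): clearing
  denominators in `M′ = M[k′]` (`exists_denom_repr`) writes `t·b = ∑ β_j c_j` with `c_j^q ∈ R₀`,
  so `θ = ∑ c_j ⊗ β_j` satisfies `θ^q = (1 ⊗ t)^q (1 ⊗ b^q)`; in the generic fibre `K′ ⊗_A D`,
  which is smooth over the FIELD `K′`, the non-zero-divisor `1 ⊗ t` then divides `θ`
  (`dvd_of_pow_dvd_pow_of_smooth`: a smooth algebra over a field is integrally closed in its
  localizations at non-zero-divisors — proved from Mathlib's local structure theorem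
  `Algebra.IsSmoothAt.exists_isStandardEtale_mvPolynomial` and the integral-closure theorem over
  the polynomial ring), and the quotient lies in `A′ ⊗_A D` by integrality. Uniqueness: the cover
  is reduced (`isReduced_of_smooth_of_isDomain`) and `q`-th powers are injective on reduced rings.
* By symmetry `A′ → B′ ⊗_B D`; the induced `crossMap`s are inverse ring isomorphisms
  (`crossEquiv`), so `A′ ⊗_A D` is smooth over `B′` as well (`smooth_crossHom`).
* A prime `z′` of `A′ ⊗_A D` over `z` (integrality over `D`) contracts to primes of `A′`, `B′`
  over `x`, `y`, which are `x′`, `y′` because `X′ → X`, `Y′ → Y` are injective for normal `X`, `Y`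
  (`prime_eq_of_comap_eq`: `b ∈ 𝔭 ↔ b^q ∈ 𝔭 ∩ A`).

## Sources

* M. Temkin, *Inseparable local uniformization*, J. Algebra 373 (2013) 65–119 =
  arXiv:0804.1554v3: §2.3, Lemma 2.3.9 (i), (ii) (p. 15); §2.8, Definition 2.8.1 and Lemma 2.8.5
  (pp. 29–31); proof of Thm. 4.1.1, Step 4 (p. 49).
* The Stacks Project, Tags 03GD, 03GE (integral closure commutes with (standard) étale base
  change) and their consequence for smooth base change, as formalized in Mathlib
  (`Mathlib.RingTheory.Smooth.IntegralClosure`, `TensorProduct.toIntegralClosure_bijective_of_smooth`);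
  used as a Mathlib theorem, no statement of this file cites it.

## Rendering notes

* As in `Temkin2013_Lemma285_normal`: `S = Spec R₀` with `κ = Frac R₀ = k(S)`; `k′ ⊇ κ` finite purely
  inseparable; `K′ ⊇ K = Frac A` a field generated over `K` by the image of `k′`
  (`Algebra.adjoin K (range (algebraMap k' K')) = ⊤`), all maps compatible over `R₀`; likewise
  `M′ ⊇ M = Frac B`; `X′ = Spec (integralClosure A K')`, `Y′ = Spec (integralClosure B M')`;
  smooth-equivalence is `AreSmoothEquivalent` (Definition 2.8.1, affine).
* The compatibility of the two routes `κ → k′ → K′` and `κ → K → K′` is isolated as `FracCompat`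
  (a consequence of the `R₀`-compatibilities, `fracCompat_of_isScalarTower`), so that the
  one-sided lemmas do not carry the base ring `R₀`. `FracCompat κ k' K K'` is a HYPOTHESIS
  PREDICATE on the data `(κ, k′, K, K′)` (like `IsIntegrallyClosed A`), taken as
  `(hc : FracCompat κ k' K K')` and discharged inside `Temkin2013_Lemma285_normal_holds`; it is not
  a closed named fact and has no `FracCompat_holds`: its universal closure is false
  (`not_fracCompat_fractionRing_polynomial`, `not_forall_fracCompat` at the end of the file:
  `K = F`, `κ = k′ = K′ = Frac F[X]`). Its binders are therefore written out explicitly rather than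
  supplied by `variable (κ k' K K') in`, which made the declaration read textually as
  `def FracCompat : Prop`.
-/

noncomputable section

open TensorProduct nonZeroDivisors

namespace Literature.AlgebraicGeometry.Resolution

universe u

section smoothField

/-- For `S` smooth over an integrally closed domain `P` with fraction field `Q`, `S` is
integrally closed in `S ⊗[P] Q` (Mathlib's "smooth base change commutes with integral closure"
applied to `P ⊆ Q`). [folklore] -/
theorem mem_range_of_isIntegral_tensor_fractionRing {P S Q : Type*} [CommRing P] [IsDomain P]
    [IsIntegrallyClosed P] [CommRing S] [Algebra P S] [Algebra.Smooth P S] [Field Q] [Algebra P Q]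
    [IsFractionRing P Q] (w : S ⊗[P] Q) (hw : IsIntegral S w) :
    w ∈ (algebraMap S (S ⊗[P] Q)).range := by
  obtain ⟨u, hu⟩ :=
    (TensorProduct.toIntegralClosure_bijective_of_smooth (R := P) (S := S) (B := Q)).2 ⟨w, hw⟩
  have key : ∀ u : S ⊗[P] integralClosure P Q,
      ((TensorProduct.toIntegralClosure P S Q u : integralClosure S (S ⊗[P] Q)) : S ⊗[P] Q) ∈
        (algebraMap S (S ⊗[P] Q)).range := by
    intro u
    induction u using TensorProduct.induction_on with
    | zero => exact ⟨0, by simp⟩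
    | tmul g c =>
      obtain ⟨z, hz⟩ := IsIntegrallyClosed.algebraMap_eq_of_integral (R := P) (K := Q) c.2
      refine ⟨z • g, ?_⟩
      change algebraMap S (S ⊗[P] Q) (z • g) =
        Algebra.TensorProduct.map (AlgHom.id S S) (integralClosure P Q).val (g ⊗ₜ c)
      rw [Algebra.TensorProduct.map_tmul, Algebra.TensorProduct.algebraMap_apply,
        Algebra.algebraMap_self, RingHom.id_apply, AlgHom.id_apply, Subalgebra.coe_val, ← hz,
        Algebra.algebraMap_eq_smul_one, TensorProduct.smul_tmul]
    | add x y hx hy =>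
      obtain ⟨a, ha⟩ := hx
      obtain ⟨b, hb⟩ := hy
      exact ⟨a + b, by rw [map_add, ha, hb, map_add]; rfl⟩
  have := key u
  rwa [hu] at this

/-- For `S` étale over a domain `P` with fraction field `Q`, non-zero-divisors of `S` become units
in `S ⊗[P] Q` (a finite, hence Artinian, `Q`-algebra). [folklore] -/
theorem isUnit_tensor_fractionRing_of_mem_nonZeroDivisors {P S Q : Type u} [CommRing P]
    [IsDomain P] [CommRing S] [Algebra P S] [Algebra.Etale P S] [Field Q] [Algebra P Q]
    [IsFractionRing P Q] {s : S} (hs : s ∈ S⁰) : IsUnit (algebraMap S (S ⊗[P] Q) s) := by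
  haveI : IsLocalization (Algebra.algebraMapSubmonoid S P⁰) (S ⊗[P] Q) :=
    IsLocalization.tensor Q P⁰
  have hsT : algebraMap S (S ⊗[P] Q) s ∈ (S ⊗[P] Q)⁰ :=
    IsLocalization.nonZeroDivisors_le_comap (M := Algebra.algebraMapSubmonoid S P⁰)
      (S := S ⊗[P] Q) hs
  haveI : Algebra.Etale Q (Q ⊗[P] S) := inferInstance
  haveI : Algebra.FormallyUnramified Q (Q ⊗[P] S) := inferInstance
  haveI : Algebra.EssFiniteType Q (Q ⊗[P] S) := inferInstance
  haveI : Module.Finite Q (Q ⊗[P] S) := Algebra.FormallyUnramified.finite_of_free Q (Q ⊗[P] S)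
  haveI : IsArtinianRing (Q ⊗[P] S) := IsArtinianRing.of_finite Q (Q ⊗[P] S)
  let e : S ⊗[P] Q ≃ₐ[P] Q ⊗[P] S := Algebra.TensorProduct.comm P S Q
  have he : e (algebraMap S _ s) ∈ (Q ⊗[P] S)⁰ := by
    refine mem_nonZeroDivisors_iff_right.mpr fun z hz => ?_
    have h1 : e.symm z * algebraMap S _ s = 0 := by
      apply e.injective
      rw [map_mul, AlgEquiv.apply_symm_apply, map_zero, hz]
    have h2 : e.symm z = 0 := (mem_nonZeroDivisors_iff_right.mp hsT) _ h1
    simpa using congrArg e h2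
  have hu := IsArtinianRing.isUnit_of_mem_nonZeroDivisors he
  simpa [e] using hu.map e.symm


variable {F G : Type u} [Field F] [CommRing G] [Algebra F G]

/-- In an algebra `G` smooth over a field `F`, a non-zero-divisor `τ` with `τ ^ q ∣ θ ^ q`
(`0 < q`) divides `θ` — `G` is integrally closed in its localizations at non-zero-divisors
(normality of smooth algebras over a field), proved affine-locally from Mathlib's local structure
theorem `Algebra.IsSmoothAt.exists_isStandardEtale_mvPolynomial` (smooth = locally standard étale
over a polynomial ring) and "smooth base change commutes with integral closure"
(`TensorProduct.toIntegralClosure_bijective_of_smooth`). [folklore] -/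
theorem dvd_of_pow_dvd_pow_of_smooth [Algebra.Smooth F G] {τ θ : G} (hτ : τ ∈ G⁰) {q : ℕ}
    (hq : 0 < q) (h : τ ^ q ∣ θ ^ q) : τ ∣ θ := by
  classical
  obtain ⟨y, hy⟩ := h
  by_contra hcon
  -- the ideal of all `g` with `τ ∣ g θ`
  let I : Ideal G := (Ideal.span {τ}).colon {θ}
  have hImem : ∀ {g : G}, g ∈ I ↔ τ ∣ g * θ := fun {g} => by
    change g ∈ (Ideal.span {τ}).colon {θ} ↔ _
    rw [Submodule.mem_colon_singleton, smul_eq_mul, Ideal.mem_span_singleton]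
  have hI : I ≠ ⊤ := by
    intro htop
    have h1 : (1 : G) ∈ I := htop ▸ Submodule.mem_top
    exact hcon (by simpa using hImem.mp h1)
  obtain ⟨m, hm, hIm⟩ := Ideal.exists_le_maximal I hI
  haveI : m.IsPrime := hm.isPrime
  haveI : Algebra.FormallySmooth G (Localization.AtPrime m) :=
    Algebra.FormallySmooth.of_isLocalization m.primeCompl
  haveI : Algebra.IsSmoothAt F m := Algebra.FormallySmooth.comp F G (Localization.AtPrime m)
  obtain ⟨f, hfm, n, _, _, _⟩ :=
    Algebra.IsSmoothAt.exists_isStandardEtale_mvPolynomial (R := F) (p := m)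
  set P := MvPolynomial (Fin n) F with hP
  set Gf := Localization.Away f with hGf
  haveI : Algebra.Etale P Gf := inferInstance
  haveI : Algebra.Smooth P Gf := inferInstance
  let Q := FractionRing P
  let T := Gf ⊗[P] Q
  haveI : IsLocalization (Algebra.algebraMapSubmonoid Gf P⁰) T := IsLocalization.tensor Q P⁰
  -- the chase
  have hτf : algebraMap G Gf τ ∈ Gf⁰ :=
    IsLocalization.nonZeroDivisors_le_comap (M := Submonoid.powers f) (S := Gf) hτ
  obtain ⟨uτ, huτ⟩ := isUnit_tensor_fractionRing_of_mem_nonZeroDivisors (P := P) (Q := Q) hτf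
  set τT := algebraMap Gf T (algebraMap G Gf τ) with hτT
  set θT := algebraMap Gf T (algebraMap G Gf θ) with hθT
  set yT := algebraMap Gf T (algebraMap G Gf y) with hyT
  have hrel : θT ^ q = τT ^ q * yT := by
    simp only [hθT, hτT, hyT, ← map_pow, ← map_mul, hy]
  let w : T := θT * ↑uτ⁻¹
  have hw : w ^ q = yT := by
    have h1 : (↑uτ : T) ^ q * (↑uτ⁻¹ : T) ^ q = 1 := by
      rw [← mul_pow, Units.mul_inv, one_pow]
    calc w ^ q = θT ^ q * (↑uτ⁻¹ : T) ^ q := by rw [mul_pow]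
      _ = yT * ((↑uτ : T) ^ q * (↑uτ⁻¹ : T) ^ q) := by rw [hrel, huτ]; ring
      _ = yT := by rw [h1, mul_one]
  have hwint : IsIntegral Gf w := by
    refine IsIntegral.of_pow hq ?_
    rw [hw]
    exact isIntegral_algebraMap
  obtain ⟨g₁, hg₁⟩ := mem_range_of_isIntegral_tensor_fractionRing (P := P) w hwint
  obtain ⟨g, ⟨_, k, rfl⟩, hgk⟩ := IsLocalization.exists_mk'_eq (Submonoid.powers f) g₁
  -- `θ = τ * g₁` in `T`, hence in `Gf`
  have hT : algebraMap Gf T (algebraMap G Gf θ) = algebraMap Gf T (algebraMap G Gf τ * g₁) := by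
    rw [map_mul, hg₁, ← hτT, ← hθT, ← huτ]
    change θT = ↑uτ * (θT * ↑uτ⁻¹)
    rw [mul_comm, mul_assoc, Units.inv_mul, mul_one]
  obtain ⟨⟨c, hc⟩, hceq⟩ :=
    (IsLocalization.eq_iff_exists (Algebra.algebraMapSubmonoid Gf P⁰) T).mp hT
  obtain ⟨s, hs, rfl⟩ := hc
  have hsreg : IsSMulRegular Gf s := Module.Flat.isSMulRegular_of_nonZeroDivisors hs
  have hGf' : algebraMap G Gf θ = algebraMap G Gf τ * g₁ := by
    apply hsreg
    simpa only [Algebra.smul_def] using hceq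
  -- clear the denominator `f ^ k`
  have hGf'' : algebraMap G Gf (f ^ k * θ) = algebraMap G Gf (τ * g) := by
    have hspec : algebraMap G Gf (f ^ k) *
        IsLocalization.mk' Gf g (⟨f ^ k, k, rfl⟩ : Submonoid.powers f) = algebraMap G Gf g :=
      IsLocalization.mk'_spec' Gf g (⟨f ^ k, k, rfl⟩ : Submonoid.powers f)
    rw [map_mul, map_mul, hGf', ← hgk, ← hspec]
    ring
  obtain ⟨⟨_, j, rfl⟩, hj⟩ := (IsLocalization.eq_iff_exists (Submonoid.powers f) Gf).mp hGf''
  have hmemI : f ^ (j + k) ∈ I := by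
    refine hImem.mpr ⟨f ^ j * g, ?_⟩
    calc f ^ (j + k) * θ = f ^ j * (f ^ k * θ) := by ring
      _ = f ^ j * (τ * g) := hj
      _ = τ * (f ^ j * g) := by ring
  exact hfm (hm.isPrime.mem_of_pow_mem _ (hIm hmemI))

end smoothField

/-! ### The exponent `q = p^e` of a finite purely inseparable extension -/

section exponent

variable (κ k' : Type u) [Field κ] [Field k'] [Algebra κ k'] [IsPurelyInseparable.HasExponent κ k']

/-- `q = p ^ e`, `p` the exponential characteristic of `κ` and `e` the exponent of the purely
inseparable extension `k'/κ` (Mathlib's `IsPurelyInseparable.exponent`): `c ^ q ∈ κ` for every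
`c ∈ k'`. [folklore] -/
abbrev insepExp : ℕ := ringExpChar κ ^ IsPurelyInseparable.exponent κ k'

/-- `0 < q`. [folklore] -/
theorem insepExp_pos : 0 < insepExp κ k' := expChar_pow_pos κ _ _

/-- `c ^ q ∈ κ` for `c ∈ k'`. [folklore] -/
theorem exists_algebraMap_eq_pow_insepExp (c : k') : ∃ z : κ, algebraMap κ k' z = c ^ insepExp κ k' :=
  IsPurelyInseparable.exponent_def κ c

end exponent

/-- A field `K'` receiving `κ → k' → K'` has the exponential characteristic of `κ`. [folklore] -/
theorem expChar_of_towers (κ k' K' : Type u) [Field κ] [Field k'] [Field K'] [Algebra κ k']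
    [Algebra k' K'] : ExpChar K' (ringExpChar κ) :=
  haveI : ExpChar k' (ringExpChar κ) :=
    expChar_of_injective_ringHom (algebraMap κ k').injective (ringExpChar κ)
  expChar_of_injective_ringHom (algebraMap k' K').injective (ringExpChar κ)

/-- `A → K'` is injective when `K'` is a field over `K = Frac A`. [folklore] -/
theorem algebraMap_injective_of_tower_fractionRing (A K K' : Type u) [CommRing A] [Field K]
    [Field K'] [Algebra A K] [IsFractionRing A K] [Algebra K K'] [Algebra A K']
    [IsScalarTower A K K'] : Function.Injective (algebraMap A K') := by
  rw [IsScalarTower.algebraMap_eq A K K']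
  exact (algebraMap K K').injective.comp (IsFractionRing.injective A K)

/-! ### One side of Lemma 2.8.5: `A ⊆ K = Frac A ⊆ K' = K[k']`, `A' = Nr_{K'}(A)` -/

/-- Compatibility of the two routes from `κ` into `K'` (through `k'` and through `K = Frac A`):
every element of `κ` lands in (the image of) `K`.

A hypothesis predicate on the data `(κ, k', K, K')`, used as `(hc : FracCompat κ k' K K')` by the
one-sided lemmas and supplied by `fracCompat_of_isScalarTower` where Lemma 2.8.5 is proved; it is not a
statement holding outright (its universal closure is false: `not_fracCompat_fractionRing_polynomial`,
`not_forall_fracCompat`), so there is no `FracCompat_holds`, and its binders are explicit (formerly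
`variable (κ k' K K') in def FracCompat : Prop`, the same declaration). [folklore] -/
def FracCompat (κ k' : Type u) [Field κ] [Field k'] [Algebra κ k'] (K K' : Type u) [Field K] [Field K']
    [Algebra K K'] [Algebra k' K'] : Prop :=
  ∀ z : κ, ∃ v : K, algebraMap K K' v = algebraMap k' K' (algebraMap κ k' z)

section side

variable {κ k' : Type u} [Field κ] [Field k'] [Algebra κ k']
variable {A K K' : Type u} [CommRing A] [Field K] [Algebra A K] [Field K'] [Algebra K K']
  [Algebra A K'] [IsScalarTower A K K'] [Algebra k' K']

/-- `FracCompat` holds when everything lives compatibly over a domain `R₀` with `κ = Frac R₀`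
and `R₀ → K` injective. [folklore] -/
theorem fracCompat_of_isScalarTower (R₀ : Type u) [CommRing R₀] [IsDomain R₀] [Algebra R₀ κ]
    [IsFractionRing R₀ κ] [Algebra R₀ k'] [IsScalarTower R₀ κ k'] [Algebra R₀ K] [Algebra R₀ K']
    [IsScalarTower R₀ K K'] [IsScalarTower R₀ k' K'] (hinj : Function.Injective (algebraMap R₀ K)) :
    FracCompat κ k' K K' := by
  intro z
  let j : κ →+* K := IsFractionRing.lift hinj
  have h : (algebraMap k' K').comp (algebraMap κ k') = (algebraMap K K').comp j := by
    refine IsLocalization.ringHom_ext (nonZeroDivisors R₀) ?_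
    ext r
    simp only [RingHom.comp_apply, j, IsFractionRing.lift_algebraMap]
    rw [← IsScalarTower.algebraMap_apply R₀ κ k', ← IsScalarTower.algebraMap_apply R₀ k' K',
      ← IsScalarTower.algebraMap_apply R₀ K K']
  exact ⟨j z, (congrArg (fun φ : κ →+* K' => φ z) h).symm⟩

variable [IsPurelyInseparable.HasExponent κ k']
variable (hK' : Algebra.adjoin K (Set.range (algebraMap k' K')) = ⊤) (hc : FracCompat κ k' K K')
include hK' hc

variable (κ k') in
/-- `K'^q ⊆ K`: every `w ∈ K' = K[k']` has `w ^ q ∈ K`. [folklore] -/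
theorem exists_algebraMap_eq_pow (w : K') : ∃ v : K, algebraMap K K' v = w ^ insepExp κ k' := by
  haveI := expChar_of_towers κ k' K'
  let S : Subalgebra K K' :=
    { carrier := {w | ∃ v : K, algebraMap K K' v = w ^ insepExp κ k'}
      mul_mem' := by
        rintro a b ⟨v, hv⟩ ⟨v', hv'⟩
        exact ⟨v * v', by rw [map_mul, hv, hv', mul_pow]⟩
      add_mem' := by
        rintro a b ⟨v, hv⟩ ⟨v', hv'⟩
        exact ⟨v + v', by rw [map_add, hv, hv', insepExp, add_pow_expChar_pow]⟩
      algebraMap_mem' := fun v => ⟨v ^ insepExp κ k', by rw [map_pow]⟩ }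
  have hle : Algebra.adjoin K (Set.range (algebraMap k' K')) ≤ S := by
    refine Algebra.adjoin_le ?_
    rintro _ ⟨c, rfl⟩
    obtain ⟨z, hz⟩ := exists_algebraMap_eq_pow_insepExp κ k' c
    obtain ⟨v, hv⟩ := hc z
    exact ⟨v, by rw [hv, hz, map_pow]⟩
  have hw : w ∈ S := hle (hK' ▸ Algebra.mem_top)
  exact hw

variable (κ k') in
/-- For `A` normal with `Frac A = K`: an element of `K'` integral over `A` has its `q`-th power
in `A` (`A' = Nr_{K'}(A) = {b : b ^ q ∈ A}`). [folklore] -/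
theorem exists_algebraMap_eq_pow_of_isIntegral [IsFractionRing A K] [IsIntegrallyClosed A]
    {b : K'} (hb : IsIntegral A b) : ∃ a : A, algebraMap A K' a = b ^ insepExp κ k' := by
  obtain ⟨v, hv⟩ := exists_algebraMap_eq_pow κ k' hK' hc b
  have hvint : IsIntegral A v := by
    have h : IsIntegral A (algebraMap K K' v) := hv ▸ hb.pow _
    exact (isIntegral_algHom_iff (IsScalarTower.toAlgHom A K K') (algebraMap K K').injective).mp h
  obtain ⟨a, ha⟩ := IsIntegrallyClosed.isIntegral_iff.mp hvint
  exact ⟨a, by rw [IsScalarTower.algebraMap_apply A K K', ha, hv]⟩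

variable [IsFractionRing A K] [IsIntegrallyClosed A]

variable (κ k') in
/-- The `q`-th power map `Nr_{K'}(A) → A` (for `A` normal). [folklore] -/
def powHom : integralClosure A K' →+* A where
  toFun b := Classical.choose (exists_algebraMap_eq_pow_of_isIntegral κ k' hK' hc b.2)
  map_one' := by
    apply algebraMap_injective_of_tower_fractionRing A K K'
    rw [Classical.choose_spec (exists_algebraMap_eq_pow_of_isIntegral κ k' hK' hc
      (1 : integralClosure A K').2), map_one]
    simp
  map_mul' b b' := by
    apply algebraMap_injective_of_tower_fractionRing A K K'
    rw [Classical.choose_spec (exists_algebraMap_eq_pow_of_isIntegral κ k' hK' hc (b * b').2),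
      map_mul, Classical.choose_spec (exists_algebraMap_eq_pow_of_isIntegral κ k' hK' hc b.2),
      Classical.choose_spec (exists_algebraMap_eq_pow_of_isIntegral κ k' hK' hc b'.2)]
    simp [mul_pow]
  map_zero' := by
    apply algebraMap_injective_of_tower_fractionRing A K K'
    rw [Classical.choose_spec (exists_algebraMap_eq_pow_of_isIntegral κ k' hK' hc
      (0 : integralClosure A K').2), map_zero, ZeroMemClass.coe_zero,
      zero_pow (insepExp_pos κ k').ne']
  map_add' b b' := by
    haveI := expChar_of_towers κ k' K'
    apply algebraMap_injective_of_tower_fractionRing A K K'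
    rw [Classical.choose_spec (exists_algebraMap_eq_pow_of_isIntegral κ k' hK' hc (b + b').2),
      map_add, Classical.choose_spec (exists_algebraMap_eq_pow_of_isIntegral κ k' hK' hc b.2),
      Classical.choose_spec (exists_algebraMap_eq_pow_of_isIntegral κ k' hK' hc b'.2)]
    simp [insepExp, add_pow_expChar_pow]

/-- Defining property of `powHom`: `powHom b = b ^ q` in `K'`. [folklore] -/
theorem algebraMap_powHom (b : integralClosure A K') :
    algebraMap A K' (powHom κ k' hK' hc b) = (b : K') ^ insepExp κ k' :=
  Classical.choose_spec (exists_algebraMap_eq_pow_of_isIntegral κ k' hK' hc b.2)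

/-- `powHom b = b ^ q` in `A'`. [folklore] -/
theorem algebraMap_powHom' (b : integralClosure A K') :
    algebraMap A (integralClosure A K') (powHom κ k' hK' hc b) = b ^ insepExp κ k' := by
  apply Subtype.val_injective
  change algebraMap A K' (powHom κ k' hK' hc b) = ((b ^ insepExp κ k' : integralClosure A K') : K')
  rw [algebraMap_powHom hK' hc b]
  simp

/-- `powHom` restricted to `A` is the `q`-th power. [folklore] -/
theorem powHom_algebraMap (a : A) :
    powHom κ k' hK' hc (algebraMap A (integralClosure A K') a) = a ^ insepExp κ k' := by
  apply algebraMap_injective_of_tower_fractionRing A K K'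
  rw [algebraMap_powHom, map_pow]
  rfl

/-- Primes of `A' = Nr_{K'}(A)` are determined by their contraction to `A` (`X' → X` is
injective): `b ∈ P ↔ b ^ q ∈ P ∩ A`. [folklore] -/
theorem mem_prime_iff_powHom_mem (P : Ideal (integralClosure A K')) [P.IsPrime]
    (b : integralClosure A K') :
    b ∈ P ↔ powHom κ k' hK' hc b ∈ P.comap (algebraMap A (integralClosure A K')) := by
  rw [Ideal.mem_comap, algebraMap_powHom']
  exact ⟨fun h => Ideal.pow_mem_of_mem P h _ (insepExp_pos κ k'), fun h => ‹P.IsPrime›.mem_of_pow_mem _ h⟩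

/-- "The preimage `x' ∈ X'` of `x`": two primes of `Nr_{K'}(A)` over the same prime of `A`
coincide. [folklore] -/
theorem prime_eq_of_comap_eq {P₁ P₂ : Ideal (integralClosure A K')} [P₁.IsPrime] [P₂.IsPrime]
    (h : P₁.comap (algebraMap A (integralClosure A K')) =
      P₂.comap (algebraMap A (integralClosure A K'))) : P₁ = P₂ := by
  ext b
  rw [mem_prime_iff_powHom_mem hK' hc P₁, mem_prime_iff_powHom_mem hK' hc P₂, h]

end side

/-! ### Denominators: `t • b ∈ ∑ A · c_j` with `c_j ^ q ∈ R₀` for every `b ∈ K'` -/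

section sideR

variable {R₀ κ k' : Type u} [CommRing R₀] [IsDomain R₀] [Field κ] [Algebra R₀ κ]
  [IsFractionRing R₀ κ] [Field k'] [Algebra κ k'] [Algebra R₀ k'] [IsScalarTower R₀ κ k']
  [IsPurelyInseparable.HasExponent κ k']
variable {A K K' : Type u} [CommRing A] [IsDomain A] [Algebra R₀ A] [FaithfulSMul R₀ A]
  [Field K] [Algebra A K] [IsFractionRing A K] [Field K'] [Algebra K K'] [Algebra A K']
  [IsScalarTower A K K'] [Algebra k' K'] [Algebra R₀ K'] [IsScalarTower R₀ k' K']
  [IsScalarTower R₀ A K']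

/-- **Clearing denominators in `K' = K[k']`**: for `b ∈ K'` there are `0 ≠ t ∈ A` and finitely
many `β_j ∈ A`, `c_j ∈ k'` with `c_j ^ q ∈ R₀` such that `t b = ∑ β_j c_j`. [folklore] -/
theorem exists_denom_repr (hK' : Algebra.adjoin K (Set.range (algebraMap k' K')) = ⊤) (b : K') :
    ∃ (t : A) (_ : t ≠ 0) (n : ℕ) (β : Fin n → A) (c : Fin n → k') (γ : Fin n → R₀),
      (∀ j, algebraMap R₀ k' (γ j) = c j ^ insepExp κ k') ∧
      algebraMap A K' t * b = ∑ j, algebraMap A K' (β j) * algebraMap k' K' (c j) := by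
  classical
  let C : Set K' := {w | ∃ c : k', (∃ γ : R₀, algebraMap R₀ k' γ = c ^ insepExp κ k') ∧
    algebraMap k' K' c = w}
  let V : Submodule A K' := Submodule.span A C
  have hC1 : (1 : K') ∈ C := ⟨1, ⟨1, by simp⟩, by simp⟩
  have hCmul : ∀ x ∈ C, ∀ y ∈ C, x * y ∈ C := by
    rintro _ ⟨c, ⟨γ, hγ⟩, rfl⟩ _ ⟨c', ⟨γ', hγ'⟩, rfl⟩
    exact ⟨c * c', ⟨γ * γ', by rw [map_mul, hγ, hγ', mul_pow]⟩, by rw [map_mul]⟩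
  have hVmul : ∀ x ∈ V, ∀ y ∈ V, x * y ∈ V := by
    intro x hx y hy
    have hle : V * V ≤ V := by
      change Submodule.span A C * Submodule.span A C ≤ Submodule.span A C
      rw [Submodule.span_mul_span]
      refine Submodule.span_le.mpr ?_
      rintro _ ⟨x, hx, y, hy, rfl⟩
      exact Submodule.subset_span (hCmul x hx y hy)
    exact hle (Submodule.mul_mem_mul hx hy)
  let W : Subalgebra K K' :=
    { carrier := {b | ∃ t : A, t ≠ 0 ∧ algebraMap A K' t * b ∈ V}
      mul_mem' := by
        rintro b b' ⟨t, ht, hb⟩ ⟨t', ht', hb'⟩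
        refine ⟨t * t', mul_ne_zero ht ht', ?_⟩
        have : algebraMap A K' (t * t') * (b * b') =
            (algebraMap A K' t * b) * (algebraMap A K' t' * b') := by rw [map_mul]; ring
        rw [this]
        exact hVmul _ hb _ hb'
      add_mem' := by
        rintro b b' ⟨t, ht, hb⟩ ⟨t', ht', hb'⟩
        refine ⟨t * t', mul_ne_zero ht ht', ?_⟩
        have : algebraMap A K' (t * t') * (b + b') =
            t' • (algebraMap A K' t * b) + t • (algebraMap A K' t' * b') := by
          simp only [Algebra.smul_def, map_mul]; ring
        rw [this]
        exact V.add_mem (V.smul_mem _ hb) (V.smul_mem _ hb')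
      algebraMap_mem' := by
        intro v
        obtain ⟨a, s, hs, rfl⟩ := IsFractionRing.div_surjective (A := A) v
        refine ⟨s, nonZeroDivisors.ne_zero hs, ?_⟩
        have hs' : algebraMap A K' s ≠ 0 :=
          (map_ne_zero_iff _ (algebraMap_injective_of_tower_fractionRing A K K')).mpr
            (nonZeroDivisors.ne_zero hs)
        have : algebraMap A K' s * algebraMap K K' (algebraMap A K a / algebraMap A K s) =
            a • (1 : K') := by
          rw [map_div₀, ← IsScalarTower.algebraMap_apply, ← IsScalarTower.algebraMap_apply,
            mul_div_cancel₀ _ hs', Algebra.smul_def, mul_one]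
        rw [this]
        exact V.smul_mem _ (Submodule.subset_span hC1) }
  have hgen : Set.range (algebraMap k' K') ⊆ W := by
    rintro _ ⟨c, rfl⟩
    obtain ⟨z, hz⟩ := exists_algebraMap_eq_pow_insepExp κ k' c
    obtain ⟨ρ, σ, hσ, rfl⟩ := IsFractionRing.div_surjective (A := R₀) z
    have hσ0 : σ ≠ 0 := nonZeroDivisors.ne_zero hσ
    have hσκ : algebraMap R₀ κ σ ≠ 0 := (map_ne_zero_iff _ (IsFractionRing.injective R₀ κ)).mpr hσ0
    refine ⟨algebraMap R₀ A σ,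
      (map_ne_zero_iff _ (FaithfulSMul.algebraMap_injective R₀ A)).mpr hσ0, ?_⟩
    refine Submodule.subset_span ⟨algebraMap R₀ k' σ * c, ⟨σ ^ (insepExp κ k' - 1) * ρ, ?_⟩, ?_⟩
    · have hq : insepExp κ k' = (insepExp κ k' - 1) + 1 :=
        (Nat.sub_add_cancel (insepExp_pos κ k')).symm
      rw [mul_pow, ← hz, IsScalarTower.algebraMap_apply R₀ κ k' σ, ← map_pow, ← map_mul,
        IsScalarTower.algebraMap_apply R₀ κ k']
      congr 1
      rw [map_mul, map_pow]
      conv_rhs => rw [hq, pow_succ]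
      field_simp
    · rw [map_mul, ← IsScalarTower.algebraMap_apply R₀ k' K', ← IsScalarTower.algebraMap_apply R₀ A K']
  have hbW : b ∈ W := Algebra.adjoin_le hgen (hK' ▸ Algebra.mem_top)
  obtain ⟨t, ht, htb⟩ := hbW
  obtain ⟨n, f, g, hsum⟩ := Submodule.mem_span_set'.mp htb
  have hg : ∀ i, ∃ c : k', (∃ γ : R₀, algebraMap R₀ k' γ = c ^ insepExp κ k') ∧
      algebraMap k' K' c = (g i : K') := fun i => (g i).2
  choose c hc using hg
  choose γ hγ using fun i => (hc i).1
  refine ⟨t, ht, n, f, c, γ, hγ, ?_⟩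
  rw [← hsum]
  refine Finset.sum_congr rfl fun i _ => ?_
  rw [Algebra.smul_def, (hc i).2]

omit [IsDomain R₀] [Algebra R₀ κ] [IsFractionRing R₀ κ] [IsScalarTower R₀ κ k'] [IsDomain A]
  [FaithfulSMul R₀ A] in
/-- The identity behind the `q`-th root: if `t b = ∑ β_j c_j` with `c_j ^ q = γ_j ∈ R₀`, then
`∑ γ_j β_j ^ q = t ^ q b ^ q` in `A` (for `b ∈ Nr_{K'}(A)`, `A` normal). [folklore] -/
theorem sum_repr_pow [IsIntegrallyClosed A] (hK' : Algebra.adjoin K (Set.range (algebraMap k' K')) = ⊤)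
    (hc : FracCompat κ k' K K') {b : integralClosure A K'} {t : A} {n : ℕ} {β : Fin n → A}
    {c : Fin n → k'} {γ : Fin n → R₀} (hγ : ∀ j, algebraMap R₀ k' (γ j) = c j ^ insepExp κ k')
    (h : algebraMap A K' t * b = ∑ j, algebraMap A K' (β j) * algebraMap k' K' (c j)) :
    ∑ j, algebraMap R₀ A (γ j) * β j ^ insepExp κ k' =
      t ^ insepExp κ k' * powHom κ k' hK' hc b := by
  haveI := expChar_of_towers κ k' K'
  apply algebraMap_injective_of_tower_fractionRing A K K'
  rw [map_mul, map_pow, algebraMap_powHom, ← mul_pow, h, map_sum]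
  have hfrob : (∑ j, algebraMap A K' (β j) * algebraMap k' K' (c j)) ^ insepExp κ k' =
      ∑ j, (algebraMap A K' (β j) * algebraMap k' K' (c j)) ^ insepExp κ k' := by
    simp only [insepExp, ← iterateFrobenius_def, map_sum]
  rw [hfrob]
  refine Finset.sum_congr rfl fun j _ => ?_
  rw [map_mul, map_pow, mul_pow, ← map_pow (algebraMap k' K'), ← hγ,
    ← IsScalarTower.algebraMap_apply, ← IsScalarTower.algebraMap_apply, mul_comm]

end sideR

/-! ### The smooth cover `Z' = Spec(A' ⊗_A D)` and its generic fibre `K' ⊗_A D` -/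

section cover

/-- `K'` is flat over `A` when `A ⊆ Frac A = K ⊆ K'`. [folklore] -/
theorem flat_of_tower_fractionRing (A K K' : Type u) [CommRing A] [IsDomain A] [Field K]
    [Algebra A K] [IsFractionRing A K] [Field K'] [Algebra K K'] [Algebra A K']
    [IsScalarTower A K K'] : Module.Flat A K' :=
  haveI : Module.Flat A K := IsLocalization.flat K (nonZeroDivisors A)
  Module.Flat.trans A K K'

variable {A K' : Type u} [CommRing A] [Field K'] [Algebra A K']
variable {D : Type u} [CommRing D] [Algebra A D]

variable (A) in
/-- A flat algebra over a domain which is non-trivial has injective structure map. [folklore] -/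
theorem algebraMap_injective_of_flat [IsDomain A] [Module.Flat A D] [Nontrivial D] :
    Function.Injective (algebraMap A D) := by
  intro a b h
  by_contra hne
  have hab : a - b ≠ 0 := sub_ne_zero.mpr hne
  have hreg : IsSMulRegular D (a - b) :=
    Module.Flat.isSMulRegular_of_nonZeroDivisors (mem_nonZeroDivisors_of_ne_zero hab)
  have h0 : (a - b) • (1 : D) = (a - b) • (0 : D) := by
    rw [smul_zero, Algebra.smul_def, map_sub, h, sub_self, zero_mul]
  exact one_ne_zero (hreg h0)

variable (A K' D) in
/-- The generic-fibre map `A' ⊗_A D → K' ⊗_A D` (`A' = Nr_{K'}(A)`). [folklore] -/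
def toGen : ↥(integralClosure A K') ⊗[A] D →ₐ[A] K' ⊗[A] D :=
  Algebra.TensorProduct.map (integralClosure A K').val (AlgHom.id A D)

/-- `toGen` on pure tensors. [folklore] -/
@[simp] theorem toGen_tmul (a : integralClosure A K') (d : D) :
    toGen A K' D (a ⊗ₜ d) = (a : K') ⊗ₜ d := rfl

/-- `A' ⊗_A D → K' ⊗_A D` is injective for `D` flat over `A`. [folklore] -/
theorem toGen_injective [Module.Flat A D] : Function.Injective (toGen A K' D) := by
  have h := Module.Flat.rTensor_preserves_injective_linearMap (M := D)
    ((integralClosure A K').val.toLinearMap) Subtype.val_injective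
  have heq : ∀ z, toGen A K' D z = ((integralClosure A K').val.toLinearMap.rTensor D) z := by
    intro z
    induction z using TensorProduct.induction_on with
    | zero => simp
    | tmul a d => rfl
    | add x y hx hy => rw [map_add, map_add, hx, hy]
  intro x y hxy
  apply h
  rw [← heq, ← heq, hxy]

/-- **Integral closure commutes with the smooth base change `A → D`** (Mathlib's
`TensorProduct.toIntegralClosure_bijective_of_smooth`, in the form used here): an element of
the generic fibre `K' ⊗_A D` with a power in (the image of) `D` comes from `A' ⊗_A D`,
`A' = Nr_{K'}(A)`. [folklore] -/
theorem exists_toGen_eq_of_pow_eq [Algebra.Smooth A D] {w : K' ⊗[A] D} {d : D} {q : ℕ}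
    (hq : 0 < q) (hw : w ^ q = (1 : K') ⊗ₜ d) : ∃ z, toGen A K' D z = w := by
  let e : K' ⊗[A] D ≃ₐ[A] D ⊗[A] K' := Algebra.TensorProduct.comm A K' D
  have hint : IsIntegral D (e w) := by
    refine IsIntegral.of_pow hq ?_
    rw [← map_pow, hw]
    change IsIntegral D (Algebra.TensorProduct.comm A K' D ((1 : K') ⊗ₜ d))
    rw [Algebra.TensorProduct.comm_tmul]
    exact isIntegral_algebraMap
  obtain ⟨u, hu⟩ :=
    (TensorProduct.toIntegralClosure_bijective_of_smooth (R := A) (S := D) (B := K')).2 ⟨e w, hint⟩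
  have key : ∀ u : D ⊗[A] integralClosure A K',
      ∃ z, toGen A K' D z = e.symm (TensorProduct.toIntegralClosure A D K' u : D ⊗[A] K') := by
    intro u
    induction u using TensorProduct.induction_on with
    | zero => exact ⟨0, by simp⟩
    | tmul d a =>
      refine ⟨a ⊗ₜ d, ?_⟩
      change (a : K') ⊗ₜ d = e.symm (Algebra.TensorProduct.map (AlgHom.id D D)
        (integralClosure A K').val (d ⊗ₜ a))
      rw [Algebra.TensorProduct.map_tmul]
      rfl
    | add x y hx hy =>
      obtain ⟨a, ha⟩ := hx
      obtain ⟨b, hb⟩ := hy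
      exact ⟨a + b, by rw [map_add, ha, hb, map_add, Subalgebra.coe_add, map_add]⟩
  obtain ⟨z, hz⟩ := key u
  refine ⟨z, ?_⟩
  rw [hz, hu]
  exact e.symm_apply_apply w

/-- For `d` a non-zero-divisor of `D`, `1 ⊗ d` is a non-zero-divisor of `K' ⊗_A D` (`K'` flat
over `A`). [folklore] -/
theorem one_tmul_mem_nonZeroDivisors [Module.Flat A K'] {d : D} (hd : d ∈ D⁰) :
    ((1 : K') ⊗ₜ[A] d) ∈ (K' ⊗[A] D)⁰ := by
  have hinj : Function.Injective (LinearMap.mulLeft A d) := fun x y hxy => by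
    have : d * x = d * y := hxy
    rw [mul_comm d x, mul_comm d y] at this
    exact (mul_cancel_right_mem_nonZeroDivisors hd).mp this
  have h := Module.Flat.lTensor_preserves_injective_linearMap (M := K') (LinearMap.mulLeft A d) hinj
  have heq : ∀ z : K' ⊗[A] D, ((1 : K') ⊗ₜ[A] d) * z = (LinearMap.mulLeft A d).lTensor K' z := by
    intro z
    induction z using TensorProduct.induction_on with
    | zero => simp
    | tmul x y => simp [Algebra.TensorProduct.tmul_mul_tmul]
    | add x y hx hy => rw [mul_add, map_add, hx, hy]
  refine mem_nonZeroDivisors_iff_right.mpr fun z hz => ?_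
  apply h
  rw [← heq, map_zero, mul_comm, hz]

/-- **`q`-th roots in the cover**: in `A' ⊗_A D` (`A` a normal domain, `D` smooth over `A`),
if `θ ^ q = (1 ⊗ d) ^ q (1 ⊗ e)` with `d` a non-zero-divisor of `D`, then `1 ⊗ e` is a `q`-th
power — via `dvd_of_pow_dvd_pow_of_smooth` in the generic fibre `K' ⊗_A D` (smooth over the
field `K'`) and `exists_toGen_eq_of_pow_eq`. [folklore] -/
theorem exists_pow_eq_one_tmul [Algebra.Smooth A D] [Module.Flat A K']
    {θ : ↥(integralClosure A K') ⊗[A] D}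
    {d e : D} (hd : d ∈ D⁰) {q : ℕ} (hq : 0 < q)
    (hθ : θ ^ q = ((1 : integralClosure A K') ⊗ₜ[A] d) ^ q * ((1 : integralClosure A K') ⊗ₜ[A] e)) :
    ∃ w : ↥(integralClosure A K') ⊗[A] D, w ^ q = (1 : integralClosure A K') ⊗ₜ[A] e := by
  have hτ : ((1 : K') ⊗ₜ[A] d) ∈ (K' ⊗[A] D)⁰ := one_tmul_mem_nonZeroDivisors hd
  have hθ' : (toGen A K' D θ) ^ q = ((1 : K') ⊗ₜ[A] d) ^ q * ((1 : K') ⊗ₜ[A] e) := by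
    rw [← map_pow, hθ, map_mul, map_pow]
    simp
  have hdvd : ((1 : K') ⊗ₜ[A] d) ^ q ∣ (toGen A K' D θ) ^ q := ⟨_, hθ'⟩
  obtain ⟨w₀, hw₀⟩ := dvd_of_pow_dvd_pow_of_smooth (F := K') hτ hq hdvd
  have hw₀q : w₀ ^ q = (1 : K') ⊗ₜ[A] e := by
    have hτq : ((1 : K') ⊗ₜ[A] d) ^ q ∈ (K' ⊗[A] D)⁰ := pow_mem hτ q
    have h1 : w₀ ^ q * ((1 : K') ⊗ₜ[A] d) ^ q = ((1 : K') ⊗ₜ[A] e) * ((1 : K') ⊗ₜ[A] d) ^ q := by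
      rw [mul_comm, ← mul_pow, ← hw₀, hθ', mul_comm]
    exact (mul_cancel_right_mem_nonZeroDivisors hτq).mp h1
  obtain ⟨z, hz⟩ := exists_toGen_eq_of_pow_eq (A := A) (K' := K') hq hw₀q
  refine ⟨z, toGen_injective ?_⟩
  rw [map_pow, hz, hw₀q]
  simp

end cover

/-- `A' ⊗_A D` (`A' = Nr_{K'}(A)`, `D` smooth and non-trivial over the domain `A ⊆ K ⊆ K'`,
`κ → k' → K'`) has the exponential characteristic of `κ`. [folklore] -/
theorem expChar_cover (κ k' A K K' D : Type u) [Field κ] [Field k'] [Algebra κ k'] [CommRing A]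
    [IsDomain A] [Field K] [Algebra A K] [IsFractionRing A K] [Field K'] [Algebra K K']
    [Algebra A K'] [IsScalarTower A K K'] [Algebra k' K'] [CommRing D] [Nontrivial D] [Algebra A D]
    [Algebra.Smooth A D] : ExpChar (↥(integralClosure A K') ⊗[A] D) (ringExpChar κ) := by
  haveI : ExpChar K' (ringExpChar κ) := expChar_of_towers κ k' K'
  haveI : ExpChar A (ringExpChar κ) :=
    RingHom.expChar (algebraMap A K') (algebraMap_injective_of_tower_fractionRing A K K') _
  haveI : ExpChar D (ringExpChar κ) :=
    expChar_of_injective_ringHom (algebraMap_injective_of_flat A (D := D)) _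
  have hinj : Function.Injective (algebraMap A ↥(integralClosure A K')) := fun a b h => by
    apply algebraMap_injective_of_tower_fractionRing A K K'
    exact congrArg (fun z : integralClosure A K' => (z : K')) h
  exact expChar_of_injective_ringHom
    (f := (Algebra.TensorProduct.includeRight : D →ₐ[A] ↥(integralClosure A K') ⊗[A] D).toRingHom)
    (Algebra.TensorProduct.includeRight_injective hinj) _

/-- `q`-th roots are unique in the (reduced) cover `A' ⊗_A D`. [folklore] -/
theorem pow_insepExp_injective (κ k' A K K' D : Type u) [Field κ] [Field k'] [Algebra κ k']
    [IsPurelyInseparable.HasExponent κ k'] [CommRing A] [IsDomain A] [Field K] [Algebra A K]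
    [IsFractionRing A K] [Field K'] [Algebra K K'] [Algebra A K'] [IsScalarTower A K K']
    [Algebra k' K'] [CommRing D] [Nontrivial D] [Algebra A D] [Algebra.Smooth A D] :
    Function.Injective fun w : ↥(integralClosure A K') ⊗[A] D => w ^ insepExp κ k' := by
  haveI := expChar_cover κ k' A K K' D
  haveI : IsReduced (↥(integralClosure A K') ⊗[A] D) :=
    isReduced_of_smooth_of_isDomain (integralClosure A K') _
  intro x y h
  have h' : iterateFrobenius _ (ringExpChar κ) (IsPurelyInseparable.exponent κ k') x =
      iterateFrobenius _ (ringExpChar κ) (IsPurelyInseparable.exponent κ k') y := by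
    rw [iterateFrobenius_def, iterateFrobenius_def]
    exact h
  exact iterateFrobenius_inj _ _ _ h'

/-! ### Comparing the two covers `A' ⊗_A D` and `B' ⊗_B D`: `q`-th roots -/

section cross

variable {R₀ κ k' : Type u} [CommRing R₀] [IsDomain R₀] [Field κ] [Algebra R₀ κ]
  [IsFractionRing R₀ κ] [Field k'] [Algebra κ k'] [Algebra R₀ k'] [IsScalarTower R₀ κ k']
  [IsPurelyInseparable.HasExponent κ k']
-- the side of `X = Spec A`
variable {A K K' : Type u} [CommRing A] [IsDomain A] [IsIntegrallyClosed A] [Algebra R₀ A]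
  [FaithfulSMul R₀ A] [Field K] [Algebra A K] [IsFractionRing A K] [Field K'] [Algebra K K']
  [Algebra A K'] [IsScalarTower A K K'] [Algebra k' K'] [Algebra R₀ K'] [IsScalarTower R₀ k' K']
  [IsScalarTower R₀ A K']
  (hK' : Algebra.adjoin K (Set.range (algebraMap k' K')) = ⊤) (hcK : FracCompat κ k' K K')
-- the side of `Y = Spec B`
variable {B M M' : Type u} [CommRing B] [IsDomain B] [IsIntegrallyClosed B] [Algebra R₀ B]
  [FaithfulSMul R₀ B] [Field M] [Algebra B M] [IsFractionRing B M] [Field M'] [Algebra M M']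
  [Algebra B M'] [IsScalarTower B M M'] [Algebra k' M'] [Algebra R₀ M'] [IsScalarTower R₀ k' M']
  [IsScalarTower R₀ B M']
  (hM' : Algebra.adjoin M (Set.range (algebraMap k' M')) = ⊤) (hcM : FracCompat κ k' M M')
-- the common smooth cover `Z = Spec D`
variable {D : Type u} [CommRing D] [Nontrivial D] [Algebra A D] [Algebra B D] [Algebra.Smooth A D]
  [Algebra.Smooth B D]
  (hcomp : (algebraMap A D).comp (algebraMap R₀ A) = (algebraMap B D).comp (algebraMap R₀ B))

include hK' hcK hM' hcM hcomp

omit [IsIntegrallyClosed A] [FaithfulSMul R₀ A] hK' hcK in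
variable (K) in
include K in
/-- **The `q`-th roots defining `Y' ← Z'`**: for `b ∈ B' = Nr_{M'}(B)`, the image of
`b ^ q ∈ B` in the cover `A' ⊗_A D` is a `q`-th power. Write `t b = ∑ β_j c_j` (`t, β_j ∈ B`,
`c_j ∈ k'`, `c_j ^ q = γ_j ∈ R₀`); then `θ = ∑ c_j ⊗ β_j` has `θ ^ q = (1 ⊗ t) ^ q (1 ⊗ b ^ q)`,
and `exists_pow_eq_one_tmul` extracts the root. [folklore] -/
theorem exists_root (b : integralClosure B M') :
    ∃ w : ↥(integralClosure A K') ⊗[A] D,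
      w ^ insepExp κ k' = (1 : integralClosure A K') ⊗ₜ[A] algebraMap B D (powHom κ k' hM' hcM b) := by
  haveI : Module.Flat A K' := flat_of_tower_fractionRing A K K'
  haveI := expChar_cover κ k' A K K' D
  obtain ⟨t, ht, n, β, c, γ, hγ, hrepr⟩ :=
    exists_denom_repr (R₀ := R₀) (κ := κ) (A := B) (K := M) hM' (b : M')
  have hsum := sum_repr_pow hM' hcM hγ hrepr
  -- the elements `c_j ∈ A'`
  have hcint : ∀ j, IsIntegral A (algebraMap k' K' (c j)) := fun j => by
    refine IsIntegral.of_pow (insepExp_pos κ k') ?_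
    rw [← map_pow, ← hγ j, ← IsScalarTower.algebraMap_apply R₀ k' K',
      IsScalarTower.algebraMap_apply R₀ A K']
    exact isIntegral_algebraMap
  let cc : Fin n → integralClosure A K' := fun j => ⟨algebraMap k' K' (c j), hcint j⟩
  have hcc : ∀ j, (cc j) ^ insepExp κ k' =
      algebraMap A (integralClosure A K') (algebraMap R₀ A (γ j)) := fun j => by
    apply Subtype.val_injective
    change algebraMap k' K' (c j) ^ insepExp κ k' = algebraMap A K' (algebraMap R₀ A (γ j))
    rw [← map_pow, ← hγ j, ← IsScalarTower.algebraMap_apply, ← IsScalarTower.algebraMap_apply]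
  let θ : ↥(integralClosure A K') ⊗[A] D := ∑ j, cc j ⊗ₜ[A] algebraMap B D (β j)
  have h1 : θ ^ insepExp κ k' =
      ∑ j, ((cc j) ^ insepExp κ k') ⊗ₜ[A] (algebraMap B D (β j) ^ insepExp κ k') := by
    simp only [θ, insepExp, ← iterateFrobenius_def, map_sum]
    refine Finset.sum_congr rfl fun j _ => ?_
    simp only [iterateFrobenius_def, Algebra.TensorProduct.tmul_pow]
  have h2 : ∀ j, ((cc j) ^ insepExp κ k') ⊗ₜ[A] (algebraMap B D (β j) ^ insepExp κ k') =
      (1 : integralClosure A K') ⊗ₜ[A]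
        algebraMap B D (algebraMap R₀ B (γ j) * β j ^ insepExp κ k') := fun j => by
    rw [hcc, Algebra.algebraMap_eq_smul_one, TensorProduct.smul_tmul, map_mul, map_pow,
      Algebra.smul_def, ← RingHom.comp_apply, hcomp, RingHom.comp_apply]
  have hθ : θ ^ insepExp κ k' =
      ((1 : integralClosure A K') ⊗ₜ[A] algebraMap B D t) ^ insepExp κ k' *
        ((1 : integralClosure A K') ⊗ₜ[A] algebraMap B D (powHom κ k' hM' hcM b)) := by
    rw [h1, Finset.sum_congr rfl fun j _ => h2 j, ← TensorProduct.tmul_sum, ← map_sum, hsum,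
      map_mul, map_pow, Algebra.TensorProduct.tmul_pow, one_pow,
      Algebra.TensorProduct.tmul_mul_tmul, one_mul]
  have hd : algebraMap B D t ∈ D⁰ := by
    refine mem_nonZeroDivisors_iff_right.mpr fun x hx => ?_
    have hreg : IsSMulRegular D t :=
      Module.Flat.isSMulRegular_of_nonZeroDivisors (mem_nonZeroDivisors_of_ne_zero ht)
    apply hreg
    change t • x = t • (0 : D)
    rw [smul_zero, Algebra.smul_def, mul_comm, hx]
  exact exists_pow_eq_one_tmul hd (insepExp_pos κ k') hθ

omit hK' hcK in
variable (K) in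
/-- **The ring map `B' = Nr_{M'}(B) → A' ⊗_A D`** (the morphism `Z' → Y'` of the printed proof):
`b ↦` the unique `q`-th root of `1 ⊗ b ^ q`. [folklore] -/
def crossHom : integralClosure B M' →+* ↥(integralClosure A K') ⊗[A] D :=
  haveI := expChar_cover κ k' A K K' D
  { toFun := fun b => Classical.choose (exists_root K hM' hcM hcomp b)
    map_one' := by
      apply pow_insepExp_injective κ k' A K K' D
      change _ ^ insepExp κ k' = (1 : ↥(integralClosure A K') ⊗[A] D) ^ insepExp κ k'
      rw [Classical.choose_spec (exists_root K hM' hcM hcomp 1), map_one, map_one, one_pow]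
      rfl
    map_mul' b b' := by
      apply pow_insepExp_injective κ k' A K K' D
      change _ ^ insepExp κ k' = (_ * _) ^ insepExp κ k'
      rw [mul_pow, Classical.choose_spec (exists_root K hM' hcM hcomp (b * b')),
        Classical.choose_spec (exists_root K hM' hcM hcomp b),
        Classical.choose_spec (exists_root K hM' hcM hcomp b'), map_mul, map_mul,
        Algebra.TensorProduct.tmul_mul_tmul, one_mul]
    map_zero' := by
      apply pow_insepExp_injective κ k' A K K' D
      change _ ^ insepExp κ k' = (0 : ↥(integralClosure A K') ⊗[A] D) ^ insepExp κ k'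
      rw [Classical.choose_spec (exists_root K hM' hcM hcomp 0), map_zero, map_zero,
        zero_pow (insepExp_pos κ k').ne', TensorProduct.tmul_zero]
    map_add' b b' := by
      haveI := expChar_cover κ k' A K K' D
      apply pow_insepExp_injective κ k' A K K' D
      change _ ^ insepExp κ k' = (_ + _) ^ insepExp κ k'
      rw [Classical.choose_spec (exists_root K hM' hcM hcomp (b + b')), map_add, map_add,
        TensorProduct.tmul_add, add_pow_expChar_pow,
        Classical.choose_spec (exists_root K hM' hcM hcomp b),
        Classical.choose_spec (exists_root K hM' hcM hcomp b')] }

omit [IsIntegrallyClosed A] [FaithfulSMul R₀ A] hK' hcK in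
/-- Defining property of `crossHom`: `(crossHom b) ^ q = 1 ⊗ b ^ q`. [folklore] -/
theorem crossHom_pow (b : integralClosure B M') :
    (crossHom K hM' hcM hcomp b) ^ insepExp κ k' =
      (1 : integralClosure A K') ⊗ₜ[A] algebraMap B D (powHom κ k' hM' hcM b) :=
  Classical.choose_spec (exists_root K hM' hcM hcomp b)

omit [IsIntegrallyClosed A] [FaithfulSMul R₀ A] hK' hcK in
/-- `crossHom` extends `B → D → A' ⊗_A D`. [folklore] -/
theorem crossHom_algebraMap (β : B) :
    crossHom K hM' hcM hcomp (algebraMap B (integralClosure B M') β) =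
      (1 : integralClosure A K') ⊗ₜ[A] algebraMap B D β := by
  apply pow_insepExp_injective κ k' A K K' D
  change _ ^ insepExp κ k' = _ ^ insepExp κ k'
  rw [crossHom_pow, powHom_algebraMap, map_pow, Algebra.TensorProduct.tmul_pow, one_pow]

omit hK' hcK in
variable (K) in
/-- **The comparison map `B' ⊗_B D → A' ⊗_A D`** induced by `crossHom` and `D → A' ⊗_A D`.
[folklore] -/
def crossMap : ↥(integralClosure B M') ⊗[B] D →+* ↥(integralClosure A K') ⊗[A] D :=
  letI : Algebra B (↥(integralClosure A K') ⊗[A] D) :=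
    ((Algebra.TensorProduct.includeRight :
        D →ₐ[A] ↥(integralClosure A K') ⊗[A] D).toRingHom.comp (algebraMap B D)).toAlgebra
  let f : integralClosure B M' →ₐ[B] ↥(integralClosure A K') ⊗[A] D :=
    { crossHom K hM' hcM hcomp with
      commutes' := fun β => crossHom_algebraMap hM' hcM hcomp β }
  let g : D →ₐ[B] ↥(integralClosure A K') ⊗[A] D :=
    { (Algebra.TensorProduct.includeRight : D →ₐ[A] ↥(integralClosure A K') ⊗[A] D).toRingHom with
      commutes' := fun _ => rfl }
  (Algebra.TensorProduct.lift f g fun _ _ => Commute.all _ _).toRingHom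

omit [IsIntegrallyClosed A] [FaithfulSMul R₀ A] hK' hcK in
/-- `crossMap` on pure tensors. [folklore] -/
@[simp] theorem crossMap_tmul (b : integralClosure B M') (d : D) :
    crossMap K hM' hcM hcomp (b ⊗ₜ d) =
      crossHom K hM' hcM hcomp b * ((1 : integralClosure A K') ⊗ₜ[A] d) :=
  rfl

/-- The comparison map in the other direction takes the `q`-th root `crossHom b` back to
`b ⊗ 1`. [folklore] -/
theorem crossMap_crossHom (b : integralClosure B M') :
    crossMap M hK' hcK hcomp.symm (crossHom K hM' hcM hcomp b) = b ⊗ₜ[B] (1 : D) := by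
  apply pow_insepExp_injective κ k' B M M' D
  change _ ^ insepExp κ k' = _ ^ insepExp κ k'
  rw [← map_pow, crossHom_pow, crossMap_tmul, map_one, one_mul, Algebra.TensorProduct.tmul_pow,
    one_pow, ← algebraMap_powHom' hM' hcM b,
    Algebra.algebraMap_eq_smul_one (A := ↥(integralClosure B M')), TensorProduct.smul_tmul,
    ← Algebra.algebraMap_eq_smul_one]

/-- The two comparison maps are mutually inverse. [folklore] -/
theorem crossMap_comp_crossMap :
    (crossMap M hK' hcK hcomp.symm).comp (crossMap K hM' hcM hcomp) = RingHom.id _ := by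
  refine RingHom.ext fun z => ?_
  induction z using TensorProduct.induction_on with
  | zero => simp
  | tmul b d =>
    rw [RingHom.comp_apply, crossMap_tmul, map_mul, crossMap_crossHom, crossMap_tmul, map_one,
      one_mul, RingHom.id_apply, Algebra.TensorProduct.tmul_mul_tmul, mul_one, one_mul]
  | add x y hx hy => rw [map_add, map_add, hx, hy]

/-- **`Z'`: the covers `B' ⊗_B D` and `A' ⊗_A D` are isomorphic** (both are the normalized
cover `Nr_{k'k(Z)}(Z)` of the printed proof). [folklore] -/
def crossEquiv : ↥(integralClosure B M') ⊗[B] D ≃+* ↥(integralClosure A K') ⊗[A] D :=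
  RingEquiv.ofRingHom (crossMap K hM' hcM hcomp) (crossMap M hK' hcK hcomp.symm)
    (crossMap_comp_crossMap hM' hcM hK' hcK hcomp.symm) (crossMap_comp_crossMap hK' hcK hM' hcM hcomp)

/-- `crossEquiv` on pure tensors. [folklore] -/
theorem crossEquiv_tmul (b : integralClosure B M') (d : D) :
    crossEquiv hK' hcK hM' hcM hcomp (b ⊗ₜ d) =
      crossHom K hM' hcM hcomp b * ((1 : integralClosure A K') ⊗ₜ[A] d) :=
  rfl

/-- **`A' ⊗_A D` is smooth over `B'`** through `crossHom` (transport of the smoothness of the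
base change `B' ⊗_B D` along `crossEquiv`). [folklore] -/
theorem smooth_crossHom :
    @Algebra.Smooth (integralClosure B M') _ (↥(integralClosure A K') ⊗[A] D) _
      (crossHom K hM' hcM hcomp).toAlgebra := by
  letI : Algebra (integralClosure B M') (↥(integralClosure A K') ⊗[A] D) :=
    (crossHom K hM' hcM hcomp).toAlgebra
  let e : ↥(integralClosure B M') ⊗[B] D ≃ₐ[integralClosure B M'] ↥(integralClosure A K') ⊗[A] D :=
    AlgEquiv.ofRingEquiv (f := crossEquiv hK' hcK hM' hcM hcomp) fun b => by
      rw [Algebra.TensorProduct.algebraMap_apply, Algebra.algebraMap_self, RingHom.id_apply,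
        crossEquiv_tmul, ← Algebra.TensorProduct.one_def, mul_one]
      rfl
  exact Algebra.Smooth.of_equiv e

end cross

/-! ### Lemma 2.8.5 for normal `X`, `Y` (`Temkin2013_Lemma285_normal`): the proof -/

/-- **Temkin 2013, Lemma 2.8.5 (normal case), PROVED.** The cover: `Z′ = Spec(A′ ⊗_A D)` for
a common smooth cover `Z = Spec D` of `(X, x)`, `(Y, y)`; it is smooth over `A′` (base change)
and over `B′` (`smooth_crossHom`: `A′ ⊗_A D ≅ B′ ⊗_B D` through the `q`-th roots `crossHom`,
which exist by "smooth base change commutes with integral closure" and normality of smooth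
algebras over a field, `dvd_of_pow_dvd_pow_of_smooth`); its prime over `z` lies over the unique
primes `x′`, `y′` of `A′`, `B′` over `x`, `y`. [cite: Temkin2013, Lemma 2.8.5] -/
theorem Temkin2013_Lemma285_normal_holds : Temkin2013_Lemma285_normal.{u} := by
  intro R₀ κ k' _ _ _ _ _ _ _ _ _ hfd hpi A K K' _ _ _ _ _ _ _ _ _ _ _ _ _ _ _ _ _ _ _ hK'
    B M M' _ _ _ _ _ _ _ _ _ _ _ _ _ _ _ _ _ _ _ hM' x y hx hy hxy x' y' hx' hy' hxx' hyy'
  obtain ⟨D, _, _, _, hcomp, hA, hB, r, hr, hrx, hry⟩ := hxy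
  haveI := hfd
  haveI := hpi
  haveI := hA
  haveI := hB
  haveI : IsPurelyInseparable.HasExponent κ k' := inferInstance
  haveI : Nontrivial D := ⟨⟨0, 1, fun h01 => hr.ne_top (Ideal.eq_top_iff_one _ |>.mpr (h01 ▸ r.zero_mem))⟩⟩
  have hinjK : Function.Injective (algebraMap R₀ K) := by
    rw [IsScalarTower.algebraMap_eq R₀ A K]
    exact (IsFractionRing.injective A K).comp (FaithfulSMul.algebraMap_injective R₀ A)
  have hinjM : Function.Injective (algebraMap R₀ M) := by
    rw [IsScalarTower.algebraMap_eq R₀ B M]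
    exact (IsFractionRing.injective B M).comp (FaithfulSMul.algebraMap_injective R₀ B)
  have hcK : FracCompat κ k' K K' := fracCompat_of_isScalarTower R₀ hinjK
  have hcM : FracCompat κ k' M M' := fracCompat_of_isScalarTower R₀ hinjM
  -- the cover `Z' = Spec (A' ⊗_A D)`
  let D' := ↥(integralClosure A K') ⊗[A] D
  letI algB' : Algebra (integralClosure B M') D' := (crossHom K hM' hcM hcomp).toAlgebra
  have hsmB' : Algebra.Smooth (integralClosure B M') D' := smooth_crossHom hK' hcK hM' hcM hcomp
  -- the prime `z'`
  letI algD : Algebra D D' :=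
    (Algebra.TensorProduct.includeRight : D →ₐ[A] D').toRingHom.toAlgebra
  haveI : IsScalarTower A D D' :=
    IsScalarTower.of_algebraMap_eq fun a =>
      ((Algebra.TensorProduct.includeRight : D →ₐ[A] D').commutes a).symm
  haveI : Algebra.IsIntegral D D' := by
    refine ⟨fun z => ?_⟩
    induction z using TensorProduct.induction_on with
    | zero => exact isIntegral_zero
    | tmul a d =>
      have ha : IsIntegral A (a ⊗ₜ[A] (1 : D) : D') :=
        (Algebra.IsIntegral.isIntegral (R := A) a).map
          (Algebra.TensorProduct.includeLeft : ↥(integralClosure A K') →ₐ[A] D')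
      have ha' : IsIntegral D (a ⊗ₜ[A] (1 : D) : D') := ha.tower_top
      have hd : IsIntegral D ((1 : integralClosure A K') ⊗ₜ[A] d : D') := isIntegral_algebraMap
      have := ha'.mul hd
      rwa [Algebra.TensorProduct.tmul_mul_tmul, mul_one, one_mul] at this
    | add u v hu hv => exact hu.add hv
  have hker : (⊥ : Ideal D').comap (algebraMap D D') ≤ r := by
    intro d hd
    rw [Ideal.mem_comap, Ideal.mem_bot] at hd
    have hinj : Function.Injective (algebraMap A ↥(integralClosure A K')) := fun a b h => by
      apply algebraMap_injective_of_tower_fractionRing A K K'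
      exact congrArg (fun z : integralClosure A K' => (z : K')) h
    have hd' : (Algebra.TensorProduct.includeRight : D →ₐ[A] D') d =
        (Algebra.TensorProduct.includeRight : D →ₐ[A] D') 0 := by
      rw [map_zero]; exact hd
    have : d = 0 := Algebra.TensorProduct.includeRight_injective hinj hd'
    rw [this]; exact r.zero_mem
  haveI := hr
  obtain ⟨r', -, hr', hr'c⟩ := Ideal.exists_ideal_over_prime_of_isIntegral r (⊥ : Ideal D') hker
  haveI := hr'
  haveI := hx'
  haveI := hy'
  refine ⟨D', inferInstance, inferInstance, algB', ?_, inferInstance, hsmB', r', hr', ?_, ?_⟩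
  · -- compatibility over `R₀`
    ext c
    change algebraMap (integralClosure A K') D' (algebraMap R₀ (integralClosure A K') c) =
      crossHom K hM' hcM hcomp (algebraMap R₀ (integralClosure B M') c)
    have hB' : algebraMap R₀ (integralClosure B M') c =
        algebraMap B (integralClosure B M') (algebraMap R₀ B c) :=
      Subtype.ext (IsScalarTower.algebraMap_apply R₀ B M' c)
    have hA' : algebraMap R₀ (integralClosure A K') c =
        algebraMap A (integralClosure A K') (algebraMap R₀ A c) :=
      Subtype.ext (IsScalarTower.algebraMap_apply R₀ A K' c)
    rw [hB', crossHom_algebraMap, hA', Algebra.TensorProduct.algebraMap_apply,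
      Algebra.algebraMap_self, RingHom.id_apply, Algebra.algebraMap_eq_smul_one,
      TensorProduct.smul_tmul, Algebra.smul_def, mul_one, ← RingHom.comp_apply, hcomp,
      RingHom.comp_apply]
  · -- `z'` lies over `x'`
    refine prime_eq_of_comap_eq hK' hcK ?_
    rw [hxx', Ideal.comap_comap, ← hrx, ← hr'c, Ideal.comap_comap]
    congr 1
    ext a
    change algebraMap (integralClosure A K') D' (algebraMap A (integralClosure A K') a) =
      algebraMap D D' (algebraMap A D a)
    rw [← IsScalarTower.algebraMap_apply, ← IsScalarTower.algebraMap_apply]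
  · -- `z'` lies over `y'`
    refine prime_eq_of_comap_eq hM' hcM ?_
    rw [hyy', Ideal.comap_comap, ← hry, ← hr'c, Ideal.comap_comap]
    congr 1
    ext β
    exact crossHom_algebraMap (K := K) hM' hcM hcomp β

/-! ### `FracCompat` is a hypothesis, not a theorem

`FracCompat κ k' K K'` only involves the four fields and the maps `κ → k' → K'`, `K → K'`; nothing forces
the image of `κ` into that of `K` unless the data come from a common base (`fracCompat_of_isScalarTower`).
The universal closure fails already for `K = F ⊊ K' = k' = κ = Frac F[X]` (the element `X`). -/

/-- `FracCompat (Frac F[X]) (Frac F[X]) F (Frac F[X])` fails for every field `F`: `X` is not the image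
of a constant. [folklore] -/
theorem not_fracCompat_fractionRing_polynomial (F : Type u) [Field F] :
    ¬ FracCompat (FractionRing (Polynomial F)) (FractionRing (Polynomial F)) F
      (FractionRing (Polynomial F)) := by
  intro h
  obtain ⟨v, hv⟩ := h (algebraMap (Polynomial F) (FractionRing (Polynomial F)) Polynomial.X)
  change algebraMap F (FractionRing (Polynomial F)) v =
    algebraMap (Polynomial F) (FractionRing (Polynomial F)) Polynomial.X at hv
  rw [IsScalarTower.algebraMap_apply F (Polynomial F) (FractionRing (Polynomial F)),
    Polynomial.algebraMap_eq] at hv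
  have hCX : (Polynomial.C v : Polynomial F) = Polynomial.X :=
    IsFractionRing.injective (Polynomial F) (FractionRing (Polynomial F)) hv
  have h01 := congrArg Polynomial.natDegree hCX
  simp at h01

/-- The universal closure of `FracCompat` is false (witness: `F = ℚ` lifted to `Type u`). [folklore] -/
theorem not_forall_fracCompat :
    ¬ ∀ (κ k' : Type u) [Field κ] [Field k'] [Algebra κ k'] (K K' : Type u) [Field K] [Field K']
      [Algebra K K'] [Algebra k' K'], FracCompat κ k' K K' :=
  fun h => not_fracCompat_fractionRing_polynomial (ULift.{u} ℚ) (h _ _ _ _)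

end Literature.AlgebraicGeometry.Resolution
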